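import Summits.Parity.GeneralizedHardyLittlewood.Theorems.LeeYangFibresRelativeDimOneFloatingNoSiegelZeros
import Summits.Parity.GeneralizedHardyLittlewood.Theorems.LeeYangFibresRelativeDimOneFloatingCalibration
import Summits.Parity.GeneralizedHardyLittlewood.Theorems.LeeYangFibresPrimeCellsRelativeHardness
import Summits.Parity.GeneralizedHardyLittlewood.Theorems.LeeYangFibresRelativeDimOne
import Literature.Barriers.Parity.SiegelZeroDichotomyNoSiegelZeros
import HarnessLib

/-!
# Route `LeeYangFibres`, crux `RelativeDimOne` (stmt-Parity-14113), line `floating-level-core` (lead seat c4):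
# THE DEBT-FREE CALIBRATION — `RelativeDimOne ↔ IncidenceBandlimitedCoreDecay (1/4) ∧ NoSiegelZeros`

The landed calibration of the line (`…FloatingCalibration.lean`, p129131) reads
`MM → (RelativeDimOne ↔ IncidenceBandlimitedCoreDecay (1/4))`, with `MM` the vendored theorem
`Literature.Barriers.Parity.MatomakiMerikoski2023_pairCorrelation` (Matomäki–Merikoski 2023, Thm 1.3; literature debt,
the registered residual stub `stub_pairCorrelation`). MM is consumed at exactly ONE place: to pass from the parity atom
P′ to rh.S34 (`stub_siegelRepulsion`). Combined with the debt-free Siegel necessity of the companion file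
(`noSiegelZeros_of_uniformCharPNT`, `…FloatingNoSiegelZeros.lean`: Tao–Teräväinen Prop. 3.5 + Mertens I), the crux gets an
UNCONDITIONAL closed form in which MM no longer appears:

* `relativeDimOne_iff_core_and_noSiegelZeros` (registered hook) —
  **`RelativeDimOne ↔ IncidenceBandlimitedCoreDecay (1/4) ∧ NoSiegelZeros`**, and `…_at` for every level `0 < θ < 1`:
  `→` by the landed necessity `coreDecay_of_relativeDimOne` and `RelativeDimOne → UniformCharPNT → NoSiegelZeros`;
  `←` by the landed stubs (A) `stub_flatSecondMoment`, (C1) `stub_typeClassMomentsFlat`, (C2) `stub_typeDataFlat`,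
  (C3) `stub_endgameFlat` (with `stub_singularWeights`, `stub_typeRigidity`);
* `noSiegelZeros_of_relativeDimOne'`, `not_relativeDimOne_of_unboundedSiegelZeros'`, `not_dimOne_of_unboundedSiegelZeros'`,
  `absoluteUpgrade_of_unboundedSiegelZeros'`, `absoluteUpgrade_iff_guarded'` — the five Siegel certificates of
  `…AbsoluteUpgradeIllusory.lean` WITHOUT their `MatomakiMerikoski2023_pairCorrelation` hypothesis;
* `noSiegelZeros_of_upperRelativeDimOne`, `noSiegelZeros_of_coarseUpperHLSlack`, `noSiegelZeros_of_primeCellsRelative` —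
  already the UPPER half of the crux (one-sided uniform Hardy–Littlewood bounds `S ≤ (1+ε)β_∞𝔖 + εN`), the upper atom
  of line `translate-amplification`, and the crux `PrimeCellsRelative` (stmt 14109's output) each PROVE rh.S34 — a
  Goldston–Suriajaya-type theorem with the full `c/log q` conclusion instead of `C/log² q`
  (cf. `Literature.Barriers.Parity.SiegelZeroPrimePairBarrier`).

So the residual of stmt-Parity-14113 is, unconditionally, the conjunction of ONE parity statement (P′) and ONE
classical zero statement (rh.S34); and modulo the theorem in print MM the second conjunct is implied by the first
(`noSiegelZeros_of_core`, landed), recovering `relativeDimOne_iff_core`.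

References: Green–Tao, Ann. of Math. 171 (2010), Conj. 1.4 [GreenTao2010]; Tao–Teräväinen, JLMS 106 (2022), Prop. 3.5
[TaoTeravainen2021]; Goldston–Suriajaya 2021, Thms 1–2 [GoldstonSuriajaya2021]; Matomäki–Merikoski, IMRN 2023, Thm 1.3
[MatomakiMerikoski2023].
-/

noncomputable section

open scoped BigOperators Classical
open Literature.NumberTheory.Sieve Literature.Barriers.Parity
open Literature.NumberTheory.LFunctions (NoSiegelZeros)
open Summit.Parity.GeneralizedHardyLittlewood.Theses.LeeYangFibres (RelativeDimOne DimOne AbsoluteUpgrade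
  PrimeCellsRelative)
open Summit.Parity.GeneralizedHardyLittlewood.Theorems.LeeYangFibresRelativeDimOne (relativeDimOne_of_dimOne)
open Summit.Parity.GeneralizedHardyLittlewood.Cruxes.RelativeDimOne.GallagherBackwards (UniformCharPNT
  UpperRelativeDimOne CoarseUpperHLSlack uniformCharPNT_of_relativeDimOne uniformCharPNT_of_upperRelativeDimOne
  uniformCharPNT_of_coarseUpperHLSlack)
open Summit.Parity.GeneralizedHardyLittlewood.Cruxes.RelativeDimOne.GallagherBackwardsSplit
open Summit.Parity.GeneralizedHardyLittlewood.Cruxes.RelativeDimOne.TypeSplit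
open Summit.Parity.GeneralizedHardyLittlewood.Cruxes.PrimeCellsRelative.Sketch (primeCellsRelative_implies_uniformCharPNT)

namespace Summit.Parity.GeneralizedHardyLittlewood.Cruxes.RelativeDimOne.FloatingLevelCore

/-! ### The sufficiency half of the line from rh.S34 (no MM) -/

/-- **The line from rh.S34**: `NoSiegelZeros → 0 < θ → θ < 1 → IncidenceBandlimitedCoreDecay θ → RelativeDimOne`, composed
BY NAME from the landed stubs (A) `stub_flatSecondMoment`, (C1) `stub_typeClassMomentsFlat`, (C2) `stub_typeDataFlat`,
(C3) `stub_endgameFlat` and the landed `stub_singularWeights`, `stub_typeRigidity`. No literature debt. -/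
theorem relativeDimOne_of_core_of_noSiegelZeros (hNSZ : NoSiegelZeros) {θ : ℝ} (hθ0 : 0 < θ) (hθ1 : θ < 1)
    (hP : IncidenceBandlimitedCoreDecay θ) : RelativeDimOne :=
  stub_endgameFlat θ hθ0 hθ1 hP
    (stub_typeDataFlat θ hθ0 hθ1 (stub_typeClassMomentsFlat (stub_flatSecondMoment hNSZ)) stub_singularWeights
      stub_typeRigidity)
    stub_typeRigidity stub_singularWeights

/-! ### The necessity of rh.S34 (no MM) -/

/-- **The crux proves rh.S34, unconditionally**: `RelativeDimOne → NoSiegelZeros`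
(`uniformCharPNT_of_relativeDimOne`, p92834, then `noSiegelZeros_of_uniformCharPNT`). The MM-conditional version is
`Theorems.AbsoluteUpgrade.noSiegelZeros_of_relativeDimOne`. [cite: TaoTeravainen2021, Proposition 3.5] -/
theorem noSiegelZeros_of_relativeDimOne' (h : RelativeDimOne) : NoSiegelZeros :=
  noSiegelZeros_of_uniformCharPNT (uniformCharPNT_of_relativeDimOne h)

/-- Siegel zeros of unbounded quality refute the crux — unconditionally (cf. the MM-conditional
`Theorems.AbsoluteUpgrade.not_relativeDimOne_of_unboundedSiegelZeros`). [cite: TaoTeravainen2021, Proposition 3.5] -/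
theorem not_relativeDimOne_of_unboundedSiegelZeros' (hU : UnboundedSiegelZeros) : ¬ RelativeDimOne :=
  fun h => not_unboundedSiegelZeros_of_uniformCharPNT (uniformCharPNT_of_relativeDimOne h) hU

/-- Siegel zeros of unbounded quality refute `DimOne` (Green–Tao Conj. 1.2 at `d = 1` as typed) — unconditionally.
[cite: GreenTao2010, Conj. 1.2] -/
theorem not_dimOne_of_unboundedSiegelZeros' (hU : UnboundedSiegelZeros) : ¬ DimOne :=
  fun hD => not_relativeDimOne_of_unboundedSiegelZeros' hU (relativeDimOne_of_dimOne hD)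

/-- In the illusory world the crux `AbsoluteUpgrade` (stmt-Parity-0817) holds vacuously — unconditionally. -/
theorem absoluteUpgrade_of_unboundedSiegelZeros' (hU : UnboundedSiegelZeros) : AbsoluteUpgrade := by
  unfold AbsoluteUpgrade
  exact fun hR => absurd hU (fun hU' => not_relativeDimOne_of_unboundedSiegelZeros' hU' hR)

/-- `AbsoluteUpgrade` is equivalent to its Siegel-guarded form — unconditionally. -/
theorem absoluteUpgrade_iff_guarded' : AbsoluteUpgrade ↔ (NoSiegelZeros → RelativeDimOne → DimOne) := by
  unfold AbsoluteUpgrade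
  exact ⟨fun h _ hR => h hR, fun h hR => h (noSiegelZeros_of_relativeDimOne' hR) hR⟩

/-- **One-sided uniform Hardy–Littlewood bounds already prove rh.S34**: `UpperRelativeDimOne → NoSiegelZeros`
(`S(Ψ,K) ≤ (1+ε)β_∞𝔖 + εN` uniformly; Goldston–Suriajaya need `(2−δ)` and get only `C/log² q`).
[cite: GoldstonSuriajaya2021, Theorem 2] [cite: TaoTeravainen2021, Proposition 3.5] -/
theorem noSiegelZeros_of_upperRelativeDimOne (h : UpperRelativeDimOne) : NoSiegelZeros :=
  noSiegelZeros_of_uniformCharPNT (uniformCharPNT_of_upperRelativeDimOne h)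

/-- The upper atom of line `translate-amplification` proves rh.S34: `CoarseUpperHLSlack → NoSiegelZeros`. -/
theorem noSiegelZeros_of_coarseUpperHLSlack (h : CoarseUpperHLSlack) : NoSiegelZeros :=
  noSiegelZeros_of_uniformCharPNT (uniformCharPNT_of_coarseUpperHLSlack h)

/-- The crux `PrimeCellsRelative` (stmt-Parity-14109) proves rh.S34 — unconditionally (cf. the MM-conditional
`PrimeCellsRelative.Sketch.primeCellsRelative_not_unboundedSiegelZeros`). -/
theorem noSiegelZeros_of_primeCellsRelative (h : PrimeCellsRelative) : NoSiegelZeros :=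
  noSiegelZeros_of_uniformCharPNT (primeCellsRelative_implies_uniformCharPNT h)

/-! ### The debt-free calibration -/

/-- **THE DEBT-FREE CALIBRATION** (registered hook of stmt-Parity-14113): unconditionally,
`RelativeDimOne ↔ IncidenceBandlimitedCoreDecay (1/4) ∧ NoSiegelZeros` — the crux is exactly its parity atom P′ together
with the classical no-Siegel-zero statement rh.S34. (Modulo Matomäki–Merikoski Thm 1.3 the second conjunct follows from
the first: `noSiegelZeros_of_core`, whence `relativeDimOne_iff_core`.) [cite: GreenTao2010, Conj. 1.4]
[cite: TaoTeravainen2021, Proposition 3.5] -/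
theorem relativeDimOne_iff_core_and_noSiegelZeros :
    Summit.Parity.GeneralizedHardyLittlewood.Theses.LeeYangFibres.RelativeDimOne ↔
      (IncidenceBandlimitedCoreDecay (1 / 4) ∧ Literature.NumberTheory.LFunctions.NoSiegelZeros) :=
  ⟨fun h => ⟨coreDecay_of_relativeDimOne (by norm_num) h, noSiegelZeros_of_relativeDimOne' h⟩,
    fun h => relativeDimOne_of_core_of_noSiegelZeros h.2 (by norm_num) (by norm_num) h.1⟩

/-- The debt-free calibration at every level `0 < θ < 1`. -/
theorem relativeDimOne_iff_core_and_noSiegelZeros_at {θ : ℝ} (hθ0 : 0 < θ) (hθ1 : θ < 1) :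
    RelativeDimOne ↔ (IncidenceBandlimitedCoreDecay θ ∧ NoSiegelZeros) :=
  ⟨fun h => ⟨coreDecay_of_relativeDimOne hθ0 h, noSiegelZeros_of_relativeDimOne' h⟩,
    fun h => relativeDimOne_of_core_of_noSiegelZeros h.2 hθ0 hθ1 h.1⟩

/-- Under rh.S34 the crux IS its parity atom, with no literature debt: `NoSiegelZeros → (RelativeDimOne ↔ P′(1/4))`. -/
theorem relativeDimOne_iff_core_of_noSiegelZeros (hNSZ : NoSiegelZeros) :
    RelativeDimOne ↔ IncidenceBandlimitedCoreDecay (1 / 4) :=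
  ⟨coreDecay_of_relativeDimOne (by norm_num), relativeDimOne_of_core_of_noSiegelZeros hNSZ (by norm_num) (by norm_num)⟩

/-- What Matomäki–Merikoski is for, exactly: the two calibrations differ by the single implication
`IncidenceBandlimitedCoreDecay (1/4) → NoSiegelZeros`, which MM supplies (`noSiegelZeros_of_core`, landed).
[cite: MatomakiMerikoski2023, Theorem 1.3] -/
theorem relativeDimOne_iff_core_of_coreImpliesNSZ
    (hPN : IncidenceBandlimitedCoreDecay (1 / 4) → NoSiegelZeros) :
    RelativeDimOne ↔ IncidenceBandlimitedCoreDecay (1 / 4) :=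
  ⟨coreDecay_of_relativeDimOne (by norm_num),
    fun hP => relativeDimOne_of_core_of_noSiegelZeros (hPN hP) (by norm_num) (by norm_num) hP⟩

example (hMM : MatomakiMerikoski2023_pairCorrelation) : RelativeDimOne ↔ IncidenceBandlimitedCoreDecay (1 / 4) :=
  relativeDimOne_iff_core_of_coreImpliesNSZ (fun hP => noSiegelZeros_of_core hMM (by norm_num) hP)

end Summit.Parity.GeneralizedHardyLittlewood.Cruxes.RelativeDimOne.FloatingLevelCore

end
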